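import Summits.CriticalPhenomena.PercolationContinuityZ3.Theorems.PercNearOneGluingNoHeavyLowerTailSahiGridPatternDiagCert

/-!
# `NoHeavyLowerTail` (crux stmt-CriticalPhenomena-4575), Sahi programme P1: **THE INTRINSIC LOWER ENVELOPE OF A DIAGONAL CERTIFICATE** —
# three all-`k` lower bounds for the certificate mass `d(F)` on a set `F` from the certificate conditions alone
# (one rectangle below `F`; two rectangles with the (T)-bound on their overlap; the complement bound)

Support file (Sahi cell, seat `prim-sahi-p1`, generation 42; `--supports stmt-CriticalPhenomena-4575`).  Pure proofs, NO definitions, no `sorry`,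
standard axioms.  Vocabulary of `…SahiGridPattern{CellForm,DiagCert}` (`lamU`, `thetaVal`).

THE MATHEMATICS (seat memo FROM-prim-sahi-p1-gen42, §2–§3).  A diagonal certificate of an up-set `V ⊆ [3]^k` is a vector `d ≥ 0` with
  (T) `Σ_{q∈W} d(q) ≤ Σ_{q∈W} λ_V(q)` for every up-set `W`,   (N) `Θ_V(X×Y) := Σ_{q∈X} Σ_{r∈Y} Θ_V(q,r) ≤ Σ_{q∈X∩Y} d(q)` for all up-sets `X, Y`.
The block rules of the certificate calculus (co-count product, generation 34) lead, for the first open outer block `x ∨ y`, to linear programmes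
`min { Σ_c m_c·d(W_c) : d a certificate of V }` (generations 40–41), and the analysis of their optimal duals shows that what a proof needs are LOWER
BOUNDS ON THE CERTIFICATE MASS `d(F)` OF A FOOTPRINT `F` THAT ARE INTRINSIC TO `V` — i.e. valid for every certificate — obtained from rectangles
`(X,Y)` OTHER than the section pair whose meet is `F` (generation 41 §2, §7.4: "principal defect rectangles", the per-footprint minimum `LB_V(F)`,
its closed form `LB2`).  This file records the three elementary envelope bounds as all-`k` lemmas:
* `cert_lower_of_subfootprint`    — ONE RECTANGLE BELOW `F`:  `X ∩ Y ⊆ F ⟹ Θ_V(X×Y) ≤ d(F)`  ((N) and `d ≥ 0`);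
* `cert_lower_two_piece`          — TWO RECTANGLES AND THE OVERLAP:  `X₁∩Y₁, X₂∩Y₂ ⊆ F ⟹ Θ_V(X₁×Y₁) + Θ_V(X₂×Y₂) − λ_V((X₁∩Y₁)∩(X₂∩Y₂)) ≤ d(F)`
  (modularity of `d`, (N) twice, (T) on the overlap, `d ≥ 0`) — this is the bound that certifies the two generation-41 instances at `V = ↑{01,10}`
  where every single rectangle (and every section word) fails (memo gen42 §1: `y(↑12 ∪ ↑21) ≥ Θ_V(↑02×↑10) + Θ_V(↑01×↑20) − λ_V(↑22) = 10 + 10 − 5`);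
* `cert_lower_complement`         — THE COMPLEMENT BOUND:  `[3]^k ∖ F ⊆ Z ⟹ 2^k·#V − λ_V(Z) ≤ d(F)`  (total mass `Σ d = 2^k·#V` from
  `diagCert_total_eq`, (T) on the up-set `Z`, `d ≥ 0`) — the `mass − T[Z]` rows of the generation-41 `k = 3` duals.
At `k = 2` the maximum of these bounds over principal/section rectangles equals the exact per-footprint minimum `LB_V(F)` for every up-set `V` and every
up-set `F` (seat computation, memo gen42 §3); nothing of that computation is asserted here.  Nothing in this file asserts `PatternPos d` for `d ≥ 4`
or Conjecture A. [this work]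
-/

namespace Summit.CriticalPhenomena.PercolationContinuityZ3.Theorems.SahiGridPattern

open Finset SahiGrid3
open scoped BigOperators

variable {k : ℕ} {V : Finset (Pd k)}

/-- **One rectangle below `F`**: if `d ≥ 0` satisfies (N) for `V` and the up-sets `X, Y` have `X ∩ Y ⊆ F`, then `Θ_V(X×Y) ≤ Σ_{q∈F} d(q)`. [this work] -/
theorem cert_lower_of_subfootprint (d : Pd k → ℤ) (hd0 : ∀ q, 0 ≤ d q)
    (hN : ∀ X X' : Finset (Pd k), IsUpperSet (X : Set (Pd k)) → IsUpperSet (X' : Set (Pd k)) →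
      (∑ q ∈ X, ∑ r ∈ X', thetaVal V q r) ≤ ∑ q ∈ X ∩ X', d q)
    {X Y F : Finset (Pd k)} (hX : IsUpperSet (X : Set (Pd k))) (hY : IsUpperSet (Y : Set (Pd k))) (hF : X ∩ Y ⊆ F) :
    (∑ q ∈ X, ∑ r ∈ Y, thetaVal V q r) ≤ ∑ q ∈ F, d q := by
  have h1 := hN X Y hX hY
  have h2 : (∑ q ∈ X ∩ Y, d q) ≤ ∑ q ∈ F, d q := Finset.sum_le_sum_of_subset_of_nonneg hF (fun q _ _ => hd0 q)
  linarith

/-- **Two rectangles and the (T)-bound on their overlap**: if `d ≥ 0` satisfies (N) and (T) for `V`, and the up-sets `X₁, Y₁, X₂, Y₂` have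
`X₁ ∩ Y₁ ⊆ F` and `X₂ ∩ Y₂ ⊆ F`, then `Θ_V(X₁×Y₁) + Θ_V(X₂×Y₂) − λ_V((X₁∩Y₁) ∩ (X₂∩Y₂)) ≤ Σ_{q∈F} d(q)`. [this work] -/
theorem cert_lower_two_piece (d : Pd k → ℤ) (hd0 : ∀ q, 0 ≤ d q)
    (hT : ∀ W : Finset (Pd k), IsUpperSet (W : Set (Pd k)) → (∑ q ∈ W, d q) ≤ ∑ q ∈ W, lamU V q)
    (hN : ∀ X X' : Finset (Pd k), IsUpperSet (X : Set (Pd k)) → IsUpperSet (X' : Set (Pd k)) →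
      (∑ q ∈ X, ∑ r ∈ X', thetaVal V q r) ≤ ∑ q ∈ X ∩ X', d q)
    {X₁ Y₁ X₂ Y₂ F : Finset (Pd k)} (hX₁ : IsUpperSet (X₁ : Set (Pd k))) (hY₁ : IsUpperSet (Y₁ : Set (Pd k)))
    (hX₂ : IsUpperSet (X₂ : Set (Pd k))) (hY₂ : IsUpperSet (Y₂ : Set (Pd k))) (hF₁ : X₁ ∩ Y₁ ⊆ F) (hF₂ : X₂ ∩ Y₂ ⊆ F) :
    (∑ q ∈ X₁, ∑ r ∈ Y₁, thetaVal V q r) + (∑ q ∈ X₂, ∑ r ∈ Y₂, thetaVal V q r) - (∑ q ∈ (X₁ ∩ Y₁) ∩ (X₂ ∩ Y₂), lamU V q)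
      ≤ ∑ q ∈ F, d q := by
  have h1 := hN X₁ Y₁ hX₁ hY₁
  have h2 := hN X₂ Y₂ hX₂ hY₂
  have hZ₁ : IsUpperSet ((X₁ ∩ Y₁ : Finset (Pd k)) : Set (Pd k)) := isUpperSet_inter_coe hX₁ hY₁
  have hZ₂ : IsUpperSet ((X₂ ∩ Y₂ : Finset (Pd k)) : Set (Pd k)) := isUpperSet_inter_coe hX₂ hY₂
  have h3 := hT ((X₁ ∩ Y₁) ∩ (X₂ ∩ Y₂)) (isUpperSet_inter_coe hZ₁ hZ₂)
  have hui : (∑ q ∈ (X₁ ∩ Y₁) ∪ (X₂ ∩ Y₂), d q) + (∑ q ∈ (X₁ ∩ Y₁) ∩ (X₂ ∩ Y₂), d q) = (∑ q ∈ X₁ ∩ Y₁, d q) + ∑ q ∈ X₂ ∩ Y₂, d q :=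
    Finset.sum_union_inter
  have hsub : (X₁ ∩ Y₁) ∪ (X₂ ∩ Y₂) ⊆ F := Finset.union_subset hF₁ hF₂
  have h4 : (∑ q ∈ (X₁ ∩ Y₁) ∪ (X₂ ∩ Y₂), d q) ≤ ∑ q ∈ F, d q := Finset.sum_le_sum_of_subset_of_nonneg hsub (fun q _ _ => hd0 q)
  linarith

/-- **The complement bound**: if `d ≥ 0` satisfies (N) and (T) for `V` and the up-set `Z` contains the complement of `F`, then
`2^k · #V − Σ_{q∈Z} λ_V(q) ≤ Σ_{q∈F} d(q)` (the total certificate mass is `2^k · #V`). [this work] -/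
theorem cert_lower_complement (d : Pd k → ℤ) (hd0 : ∀ q, 0 ≤ d q)
    (hT : ∀ W : Finset (Pd k), IsUpperSet (W : Set (Pd k)) → (∑ q ∈ W, d q) ≤ ∑ q ∈ W, lamU V q)
    (hN : ∀ X X' : Finset (Pd k), IsUpperSet (X : Set (Pd k)) → IsUpperSet (X' : Set (Pd k)) →
      (∑ q ∈ X, ∑ r ∈ X', thetaVal V q r) ≤ ∑ q ∈ X ∩ X', d q)
    {F Z : Finset (Pd k)} (hZ : IsUpperSet (Z : Set (Pd k))) (hFZ : univ \ F ⊆ Z) :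
    2 ^ k * (V.card : ℤ) - (∑ q ∈ Z, lamU V q) ≤ ∑ q ∈ F, d q := by
  have htot := diagCert_total_eq V d hT hN
  have h1 := hT Z hZ
  have h2 : (∑ q ∈ univ \ F, d q) ≤ ∑ q ∈ Z, d q := Finset.sum_le_sum_of_subset_of_nonneg hFZ (fun q _ _ => hd0 q)
  have h3 : (∑ q ∈ univ \ F, d q) + (∑ q ∈ F, d q) = ∑ q : Pd k, d q := by
    rw [Finset.sum_sdiff (Finset.subset_univ F)]
  linarith

/-- **One rectangle below `F`, with the trivial part of the mass elsewhere**: if moreover the up-set `W ⊆ F` is disjoint from `X ∩ Y`, then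
`Θ_V(X×Y) + 2^k · #(V ∩ W) ≤ Σ_{q∈F} d(q)` ((N) at `(X,Y)` and at `(⊤,W)`). [this work] -/
theorem cert_lower_of_subfootprint_add (d : Pd k → ℤ) (hd0 : ∀ q, 0 ≤ d q)
    (hN : ∀ X X' : Finset (Pd k), IsUpperSet (X : Set (Pd k)) → IsUpperSet (X' : Set (Pd k)) →
      (∑ q ∈ X, ∑ r ∈ X', thetaVal V q r) ≤ ∑ q ∈ X ∩ X', d q)
    {X Y W F : Finset (Pd k)} (hX : IsUpperSet (X : Set (Pd k))) (hY : IsUpperSet (Y : Set (Pd k))) (hW : IsUpperSet (W : Set (Pd k)))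
    (hF : X ∩ Y ⊆ F) (hWF : W ⊆ F) (hdis : Disjoint (X ∩ Y) W) :
    (∑ q ∈ X, ∑ r ∈ Y, thetaVal V q r) + 2 ^ k * ((V ∩ W).card : ℤ) ≤ ∑ q ∈ F, d q := by
  have h1 := hN X Y hX hY
  have h2 := diagCert_lower_of_N V d hN W hW
  have hu : (∑ q ∈ (X ∩ Y) ∪ W, d q) = (∑ q ∈ X ∩ Y, d q) + ∑ q ∈ W, d q := Finset.sum_union hdis
  have hsub : (X ∩ Y) ∪ W ⊆ F := Finset.union_subset hF hWF
  have h3 : (∑ q ∈ (X ∩ Y) ∪ W, d q) ≤ ∑ q ∈ F, d q := Finset.sum_le_sum_of_subset_of_nonneg hsub (fun q _ _ => hd0 q)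
  linarith

end Summit.CriticalPhenomena.PercolationContinuityZ3.Theorems.SahiGridPattern
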